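import Mathlib.LinearAlgebra.Eigenspace.Triangularizable
import HarnessLib

/-!
# A commuting family of endomorphisms of a finite-dimensional space over an algebraically closed
# field has a common eigenvector

Topic `LinearAlgebra`; namespace `Literature.LinearAlgebra`. Theorems only (no definition, no named
fact). The textbook fact `exists_ne_zero_forall_apply_eq_smul_of_commute`: pairwise commuting
endomorphisms `T i` (`i ∈ ι`, any index type) of a non-zero finite-dimensional vector space over an
algebraically closed field have a common eigenvector. Proof: induction on the dimension — if every
`T i` is a scalar any non-zero vector works; otherwise some `T i₀` has a proper non-zero eigenspace,
which is stable under every `T i`, and the induction hypothesis applies to the restrictions.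
(Mathlib has the single-operator `Module.End.exists_eigenvalue` and the simultaneous GENERALISED
eigenspace decomposition `Module.End.iSup_iInf_maxGenEigenspace_eq_top_of_…_commute`; the tree's
`CommonEigenvectorLifting` lifts common eigenvectors from quotients.) Used for the `K_∞`-weight
vectors of the archimedean Hecke theory of `GL₂` (`NumberTheory/Automorphic/ArchTestVector…`).

## References

* J. E. Humphreys, *Introduction to Lie Algebras and Representation Theory*, GTM 9, Springer 1972,
  §4.1 (proof of Lie's theorem, abelian case). [folklore]
-/

open Module

namespace Literature.LinearAlgebra

/-- **A commuting family of endomorphisms of a non-zero finite-dimensional vector space over an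
algebraically closed field has a common eigenvector.** [folklore] -/
theorem exists_ne_zero_forall_apply_eq_smul_of_commute {F : Type*} [Field F] [IsAlgClosed F]
    {V : Type*} [AddCommGroup V] [Module F V] [FiniteDimensional F V] [Nontrivial V]
    {ι : Type*} (T : ι → Module.End F V) (hT : ∀ i j, Commute (T i) (T j)) :
    ∃ v : V, v ≠ 0 ∧ ∀ i, ∃ a : F, T i v = a • v := by
  -- induction on the dimension, for all spaces at once
  suffices h : ∀ (n : ℕ) (W : Type _) [AddCommGroup W] [Module F W] [FiniteDimensional F W] [Nontrivial W]
      (S : ι → Module.End F W), (∀ i j, Commute (S i) (S j)) → finrank F W ≤ n →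
      ∃ v : W, v ≠ 0 ∧ ∀ i, ∃ a : F, S i v = a • v from
    h (finrank F V) V T hT le_rfl
  intro n
  induction n with
  | zero =>
    intro W _ _ _ _ S _ hn
    exact absurd (le_antisymm hn (Nat.zero_le _)) (finrank_pos (R := F) (M := W)).ne'
  | succ n ih =>
    intro W _ _ _ _ S hS hn
    by_cases hscal : ∀ i, ∃ a : F, S i = a • (1 : Module.End F W)
    · obtain ⟨v, hv⟩ := exists_ne (0 : W)
      refine ⟨v, hv, fun i => ?_⟩
      obtain ⟨a, ha⟩ := hscal i
      exact ⟨a, by rw [ha]; rfl⟩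
    push Not at hscal
    obtain ⟨i₀, hi₀⟩ := hscal
    obtain ⟨a, ha⟩ := Module.End.exists_eigenvalue (S i₀)
    set U : Submodule F W := (S i₀).eigenspace a with hU
    -- `U` is non-zero, proper and stable under every `S i`
    have hU0 : U ≠ ⊥ := fun h => ha (by rw [hU] at h; exact h)
    have hUtop : U ≠ ⊤ := by
      intro htop
      apply hi₀ a
      ext w
      have hw : w ∈ U := htop ▸ Submodule.mem_top
      rw [hU, Module.End.mem_eigenspace_iff] at hw
      rw [hw]; rfl
    have hmaps : ∀ i, ∀ u ∈ U, S i u ∈ U := fun i u hu => by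
      rw [hU, Module.End.mem_eigenspace_iff] at hu ⊢
      rw [← Module.End.mul_apply, (hS i₀ i).eq, Module.End.mul_apply, hu, map_smul]
    haveI : Nontrivial U := Submodule.nontrivial_iff_ne_bot.2 hU0
    have hlt : finrank F U < finrank F W := Submodule.finrank_lt hUtop
    obtain ⟨u, hu0, hu⟩ := ih U (fun i => (S i).restrict (hmaps i)) (fun i j => by
      ext x
      simp only [Module.End.mul_apply, LinearMap.coe_restrict_apply]
      rw [← Module.End.mul_apply, (hS i j).eq, Module.End.mul_apply]) (by omega)
    refine ⟨(u : W), fun h => hu0 (Subtype.ext h), fun i => ?_⟩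
    obtain ⟨b, hb⟩ := hu i
    refine ⟨b, ?_⟩
    have h := congrArg Subtype.val hb
    simpa only [LinearMap.coe_restrict_apply, Submodule.coe_smul] using h

/-- The same for a family indexed by a set of endomorphisms. [folklore] -/
theorem exists_ne_zero_forall_mem_apply_eq_smul_of_commute {F : Type*} [Field F] [IsAlgClosed F]
    {V : Type*} [AddCommGroup V] [Module F V] [FiniteDimensional F V] [Nontrivial V]
    (𝒯 : Set (Module.End F V)) (h𝒯 : ∀ S ∈ 𝒯, ∀ T ∈ 𝒯, Commute S T) :
    ∃ v : V, v ≠ 0 ∧ ∀ T ∈ 𝒯, ∃ a : F, T v = a • v := by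
  obtain ⟨v, hv, h⟩ := exists_ne_zero_forall_apply_eq_smul_of_commute (fun T : 𝒯 => (T : Module.End F V))
    (fun S T => h𝒯 S S.2 T T.2)
  exact ⟨v, hv, fun T hT => h ⟨T, hT⟩⟩

end Literature.LinearAlgebra
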